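import Summits.Ventures.HodgeRepro2.T5SU11LegendreChebyshev

/-!
# The values at the origin `P_{2m}(0) = (−1)^m a_m`, `P_{2m+1}(0) = 0`, and the alternating binomial identity
`Σ_{k ≤ 2m} (−1)^k C(2k,k) C(4m−2k, 2m−k) = 4^m C(2m,m)`

Bonnet's recursion at `x = 0` reads `(n + 2) P_{n+2}(0) = −(n + 1) P_n(0)`, so with `a_k = C(2k,k)/4^k` and
`(k + 1) a_{k+1} = (k + ½) a_k`: **`P_{2m}(0) = (−1)^m a_m`** and **`P_{2m+1}(0) = 0`** (`legP_zero_even`,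
`legP_zero_odd`). Heine's formula on the circle (`T5SU11LegendreChebyshev.legP_cos_eq_sum`) at `θ = π/2` gives the same
values as `Σ_k a_k a_{n−k} cos((2k − n)π/2)`; comparing the two evaluations proves the alternating convolution identity
**`Σ_{k ≤ 2m} (−1)^k a_k a_{2m−k} = a_m`** (`sum_alternating_binomHalf`), i.e.
**`Σ_{k ≤ 2m} (−1)^k C(2k,k) C(4m−2k, 2m−k) = 4^m C(2m,m)`** in `ℤ` (`sum_alternating_centralBinom`) — the coefficient
identity of `B(z) B(−z) = B(z²)` for `B = (1 − z)^{−1/2}`, obtained here from the group's Legendre polynomials.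
Nothing is claimed about (N).

Blind lane: Mathlib + the HodgeRepro2 prefix only; no sorry; axioms ⊆ {propext, Classical.choice,
Quot.sound}.
-/

namespace Summit.Ventures.HodgeRepro2.T5SU11LegendreAtZero

open Finset
open T5SU11SphericalLegendreAll T5SU11LegendreHeine T5SU11LegendreChebyshev

/-! ### Bonnet at the origin -/

/-- `P_{n+2}(0) = −((n + 1)/(n + 2)) P_n(0)`. -/
theorem legP_zero_succ_succ (n : ℕ) : legP (n + 2) 0 = -(((n : ℝ) + 1) / ((n : ℝ) + 2)) * legP n 0 := by
  rw [legP_succ_succ]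
  ring

/-- **`P_{2m}(0) = (−1)^m a_m`** and **`P_{2m+1}(0) = 0`**, jointly by induction. -/
theorem legP_zero_pair (m : ℕ) : legP (2 * m) 0 = (-1) ^ m * binomHalf m ∧ legP (2 * m + 1) 0 = 0 := by
  induction m with
  | zero => simp
  | succ m ih =>
    obtain ⟨h0, h1⟩ := ih
    constructor
    · rw [show 2 * (m + 1) = 2 * m + 2 by ring, legP_zero_succ_succ, h0]
      have h := binomHalf_succ m
      have hm : ((m : ℝ) + 1) ≠ 0 := by positivity
      have e : binomHalf (m + 1) = ((m : ℝ) + 1 / 2) / ((m : ℝ) + 1) * binomHalf m := by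
        rw [div_mul_eq_mul_div, eq_div_iff hm]
        linarith [h]
      rw [e, pow_succ]
      push_cast
      field_simp
    · rw [show 2 * (m + 1) + 1 = 2 * m + 1 + 2 by ring, legP_zero_succ_succ, h1, mul_zero]

/-- **`P_{2m}(0) = (−1)^m C(2m,m)/4^m`.** -/
theorem legP_zero_even (m : ℕ) : legP (2 * m) 0 = (-1) ^ m * binomHalf m := (legP_zero_pair m).1

/-- **`P_{2m+1}(0) = 0`.** -/
theorem legP_zero_odd (m : ℕ) : legP (2 * m + 1) 0 = 0 := (legP_zero_pair m).2

/-! ### Heine on the circle at `θ = π/2` -/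

/-- `cos((2k − 2m) π/2) = cos((k − m)π) = (−1)^{k+m}`. -/
theorem cos_sub_mul_pi (k m : ℕ) : Real.cos (((2 * (k : ℤ) - (2 * m : ℕ) : ℤ) : ℝ) * (Real.pi / 2)) = (-1) ^ (k + m) := by
  have e : (((2 * (k : ℤ) - (2 * m : ℕ) : ℤ) : ℝ) * (Real.pi / 2)) = ((k : ℤ) - m : ℤ) * Real.pi := by
    push_cast
    ring
  rw [e, Real.cos_int_mul_pi]
  -- `(−1)^(k − m : ℤ) = (−1)^(k + m)`
  rw [show ((k : ℤ) - m) = (k + m : ℕ) - 2 * (m : ℤ) by push_cast; ring, zpow_sub₀ (by norm_num),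
    zpow_mul, zpow_natCast]
  norm_num

/-- **Heine at `θ = π/2`**: `P_{2m}(0) = (−1)^m Σ_{k ≤ 2m} (−1)^k a_k a_{2m−k}`. -/
theorem legP_zero_eq_alternating_sum (m : ℕ) :
    legP (2 * m) 0 = (-1) ^ m * ∑ k ∈ range (2 * m + 1), (-1) ^ k * (binomHalf k * binomHalf (2 * m - k)) := by
  have h := legP_cos_eq_sum (2 * m) (Real.pi / 2)
  rw [Real.cos_pi_div_two] at h
  rw [h, Finset.mul_sum]
  refine Finset.sum_congr rfl fun k _ => ?_
  rw [cos_sub_mul_pi, pow_add]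
  ring

/-- **The alternating convolution identity `Σ_{k ≤ 2m} (−1)^k a_k a_{2m−k} = a_m`.** -/
theorem sum_alternating_binomHalf (m : ℕ) :
    ∑ k ∈ range (2 * m + 1), (-1) ^ k * (binomHalf k * binomHalf (2 * m - k)) = binomHalf m := by
  have h1 := legP_zero_even m
  have h2 := legP_zero_eq_alternating_sum m
  rw [h1] at h2
  have hs : ((-1 : ℝ) ^ m) * ((-1 : ℝ) ^ m) = 1 := by rw [← pow_add, ← two_mul, pow_mul]; norm_num
  calc ∑ k ∈ range (2 * m + 1), (-1) ^ k * (binomHalf k * binomHalf (2 * m - k))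
      = ((-1 : ℝ) ^ m * (-1) ^ m) * ∑ k ∈ range (2 * m + 1), (-1) ^ k * (binomHalf k * binomHalf (2 * m - k)) := by
        rw [hs, one_mul]
    _ = (-1 : ℝ) ^ m * ((-1) ^ m * binomHalf m) := by rw [mul_assoc, ← h2]
    _ = binomHalf m := by rw [← mul_assoc, hs, one_mul]

/-- **`Σ_{k ≤ 2m} (−1)^k C(2k,k) C(4m−2k, 2m−k) = 4^m C(2m,m)`** in `ℤ`. -/
theorem sum_alternating_centralBinom (m : ℕ) :
    ∑ k ∈ range (2 * m + 1), (-1 : ℤ) ^ k * ((2 * k).choose k * (2 * (2 * m - k)).choose (2 * m - k) : ℤ)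
      = 4 ^ m * (2 * m).choose m := by
  have h := sum_alternating_binomHalf m
  have e : ∀ k ∈ range (2 * m + 1), (-1 : ℝ) ^ k * (binomHalf k * binomHalf (2 * m - k))
      = (((-1 : ℤ) ^ k * ((2 * k).choose k * (2 * (2 * m - k)).choose (2 * m - k) : ℤ) : ℤ) : ℝ) / 4 ^ (2 * m) :=
    fun k hk => by
    have hk' : k ≤ 2 * m := Nat.lt_succ_iff.mp (Finset.mem_range.mp hk)
    unfold binomHalf
    rw [div_mul_div_comm, ← pow_add, Nat.add_sub_cancel' hk']
    push_cast
    ring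
  rw [Finset.sum_congr rfl e, ← Finset.sum_div, div_eq_iff (by positivity)] at h
  have h' : ((∑ k ∈ range (2 * m + 1), (-1 : ℤ) ^ k * ((2 * k).choose k * (2 * (2 * m - k)).choose (2 * m - k) : ℤ) : ℤ) : ℝ)
      = ((4 ^ m * (2 * m).choose m : ℤ) : ℝ) := by
    rw [Int.cast_sum, h]
    unfold binomHalf
    push_cast
    rw [show (4 : ℝ) ^ (2 * m) = 4 ^ m * 4 ^ m by rw [← pow_add, two_mul]]
    field_simp
  exact_mod_cast h'

end Summit.Ventures.HodgeRepro2.T5SU11LegendreAtZero
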